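import Summits.QuantumFields.YangMills.Theorems.BalabanUVNodesN15KingModelThm33AtRegularField
import Literature.MathematicalPhysics.QuantumFieldTheory.Balaban1983to89.B9

/-!
# Route «BalabanUVNodes», node N15 = NE2 — THE KING-MODEL RUNG, PART Θ⁺-b: [B9] THEOREM 3.15 (3.187)
# `|C^{(k)}(Λ; y, y′)| ≤ B₀e^{−δ₀|y−y′|}` **BY NAME (`B9.Thm315Printed`) AT LIVE REGULAR BACKGROUNDS — `Reg335` READ, NOT ONE-POINT —**
# in the abelian (Higgs)₂,₃ model, from r14's proof of [Ba1] Proposition 2.3 (2.34) at a regular torus field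

Cell `pub-ymgap`, Track A (D-0062), seat `pub-ymgap-dag-n15-e` (R141 (C), s3 «King-model rung»), generation 21, companion of PART Θ⁺
(`…N15KingModelThm33AtRegularField`, p676497: King's Theorem 3.3 BY NAME at a regular field).  `bears_on: R4∕N15`;
`--supports stmt-QuantumFields-27366` (K3⁸, `--as helper`).  COUNT-NEUTRAL.  Namespace `…N15KingModelRung.Curved`.

THE PRINT.  [B9] = [Balaban1985BackgroundPropagators] T. Bałaban, *Propagators for lattice gauge theories in a background field*, CMP **99**
(1985) 389–434, Theorem 3.15 p. 432 (verbatim in the docstring of `B9.Thm315Printed`): *«For Mα₀ sufficiently small the propagator C^{(k)}(Λ) is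
given by the formula (3.185), and satisfies the bound |C^{(k)}(Λ; y, y′)| ≤ B₀e^{−δ₀|y−y′|}, y, y′ ∈ Λ (3.187) with the constants B₀, δ₀ depending on
d and L only.»* under (3.35)–(3.36) p. 396 *«|A| < O(1)Mα₀(L^jη)^{−1}, |∇^ηA| < O(1)Mα₀(L^jη)^{−2}»*.  [Ba1] = [Balaban1982Higgs1] CMP **85** (1982)
603–626, Proposition 2.3 (2.32)–(2.34) pp. 611–612: *«|C^{(k)}_Λ(Ω, A; x, x′)| ≤ c₀exp(−δ₀|x − x′|), x, x′ ∈ Λ (2.34)»* at a (2.23)-regular `A`.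

WHAT THIS FILE PROVES (0 `sorry`; the `def`s are carrier plumbing for the [B9] schema, no `Prop`-valued fact).
* §1 `HiggsCovIdx d L K₀` — the FAMILY INDEX: a torus of the (Higgs)₂,₃ carrier in r14's cubic sub-family (`Shape P`, `P.d = d`, `P.L = L`, cube
  size `K₀` with `K₀ ∣ M`, `3K₀ ≤ 2M`), a level `1 ≤ k < K_P` with `L^kε ≤ 1`, and a set `Λ ⊂ T₁^{(k)}`; `higgsCovIdx_nonempty` (members exist at every
  cube size `K₀ = L^r`).  ★ `higgsGeo C i : B9.Geometry` — sites = the unit lattice `T^{(k)}` of the carrier (`HiggsLattice.Site P k`), `dist` = the (1.3)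
  distance (unit-lattice units), all sites of scale `k`, `η = L^{−k}`, the big-cube size `M := K₀`, `Loc` = η-lattice fields `T_ε → ℝ^N` with `supp ⊂ B^k(y)`
  resp. `⊂` the blocks within distance `1`, sup norm `‖·‖`; the weighted ∕ Hölder ∕ `L²` ∕ cut-off fields are INERT (`0`, `Unit`) — Theorem 3.15 reads
  none of them.  ★ `higgsBg C i : B9.Backgrounds` — `Cfg := HiggsLattice.VecField P 0` (real vector fields on the bonds of `T_ε`), `one := 0`,
  `mul := (+)` (abelian: `U′U ↔ A′ + A`), **`Reg335 c α₀ A := ∀ z μ ν, L^k·|e|·|A_μ(z + εe_ν) − A_μ(z)| ≤ c·α₀`** — the GRADIENT clause of (3.35)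
  in the model's one-parameter currency «charge × unit-lattice gradient small» (r14's `L^kδ|e| ≤ t`; the sup clause `|A| < O(1)Mα₀(L^jη)^{−1}` of
  (3.35) is gauge bookkeeping on each cube and is NOT modelled), `Reg336` = the same for second differences (typed, UNUSED here), `Cplx337`,
  `Cplx338 := False` (no complexified fields on this real carrier — every schema READING them is VACUOUS on this family; Theorem 3.15 does
  not).  ★ `higgsCk C a m² i : B9.SiteKernel` — `ker A y y′ := (L^kε)^{−2}·‖C^{(k),L^kε}_Λ(T_ε, A)(y, y′)‖₁`, the `ℓ¹` block norm (Θ⁺'s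
  `blockNormK`) of r14's `HiggsCondCov232.condCov232 … Λ` ([Ba1] (2.32), rescaled to the unit lattice by (2.30)∕(2.31)).
* §3 ★★ **`thm33Printed_king_of_isRegular35`** — PART Θ⁺ with KING's DEFINITION 3.2 (3.5) BY NAME (`ContinuumLimit.IsRegular35` on `T_η`) as the
  hypothesis: both ends of Theorem 3.3 by name (`oneStep_of_isRegular35`, `isRegular35_rhs_nonneg`); `thm33_family_nonempty` (PART Θ⁺'s side
  conditions are met above every threshold: cube size `L^r`, the torus of `higgsCovIdx_nonempty`).
* §2 ★★★ **`thm315Printed_higgs_regularField`**: for `L` odd `> 1`, `a, m² > 0`, `N`, `(e, q)` there is a cube size `K₀ = L^r` such that for EVERY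
  `c₃₅ > 0`: `B9.Thm315Printed c₃₅ (higgsGeo C) (higgsBg C) (higgsCk C a m²) (fun i y => y ∈ i.Λ) (fun i y y′ => |y − y′|)` — i.e. `∃ δ₀ a₀ B₀ > 0
  ∀ i ∀ α₀ > 0, Mα₀ ≤ a₀ → ∀ A, Reg335 c₃₅ α₀ A → Reg336 c₃₅ α₀ A → ∀ y y′ ∈ Λ, |C^{(k)}_Λ(T, A)(y, y′)| ≤ B₀e^{−δ₀|y−y′|}` — from r14 g13
  `B1Props21to23RegularTorus.ineq234_236_regular_torus_std` ([Ba1] (2.34) at a regular torus field, EVERY `Λ`) BY NAME: `a₀ := t(K₀)·K₀∕c₃₅`, the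
  regularity parameter `δ` := THE ACTUAL maximum of the one-step differences of `A` (so `L^kδ|e| ≤ c₃₅α₀ ≤ t(K₀)` by `Reg335` at the maximiser),
  `B₀ := N²·c₁(K₀)`, `δ₀ := δ₁(K₀)`; `Reg336` is carried and not used.  `reg335_higgsBg_zero` (non-vacuity: `A = 0` is in every window) and
  `reg335_higgsBg_of_oneStep` (every field with `L^k|e|·(one-step differences) ≤ c₃₅α₀` is in the window — the window is LIVE).

HONEST FRAMING ∕ SCOPE.  (i) A KNIT: [B9] Theorem 3.15's display inhabited at LIVE regular backgrounds by r14's theorem already in the tree; no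
estimate is new.  (ii) The OBJECT is the abelian scalar model's conditional fluctuation covariance `C^{(k)}_Λ(T_ε, A) = ((aL^{−2}P(A) +
Δ^{(k)}(T_ε, A))↾_Λ)^{−1}` of [Ba1] (2.32) — the (Higgs)₂,₃ analogue of, NOT Bałaban's gauge-field `C^{(k)}(Λ) = (I + D̄μ)QG̃₂Q*(I + μ*D̄*)` of [B9]
(3.185); the formula half of Theorem 3.15 («is given by (3.185)») is not a statement about this object and is not claimed.  (iii) `Λ` arbitrary (the
print's «union of big blocks» is not needed by (2.34)); `Ω = T_ε`; cubic tori of r14's sub-family, `L` odd `≥ 3`, `m² > 0`, `1 ≤ k < K_P`, `L^kε ≤ 1`;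
constants existential, per cube size `K₀` (fixed for the family), weaker than the print's «depending on d and L only».  (iv) `|C(y, y′)|` := the `ℓ¹`
entry norm of the `N×N` block.  (v) Single-spacing SIZE, not an η-rate: NE2's unit-layer η-difference at live backgrounds is NOT in the tree.  NE2⁺ NOT
printed ∕ not proved; NOT a node discharge; counts untouched; nothing continuum ∕ ℝ⁴ ∕ OS ∕ mass-gap ∕ Clay.
-/

noncomputable section

open scoped BigOperators

namespace Summit.QuantumFields.YangMills.BalabanUVNodes.N15KingModelRung.Curved

open Literature.MathematicalPhysics.QuantumFieldTheory.Balaban1983to89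
open Literature.MathematicalPhysics.QuantumFieldTheory.Balaban1983to89.HiggsLattice (ChargeData)
open Literature.MathematicalPhysics.QuantumFieldTheory.Balaban1983to89.HiggsAveraging (blockIter)
open Literature.MathematicalPhysics.QuantumFieldTheory.Balaban1983to89.HiggsCondCov232 (condCov232)
open Literature.MathematicalPhysics.QuantumFieldTheory.Balaban1983to89.B1Eq230FluctCov (mat Ix)
open Literature.MathematicalPhysics.QuantumFieldTheory.Balaban1983to89.B1Eq211ZeroFieldTorus (Shape)
open Literature.MathematicalPhysics.QuantumFieldTheory.Balaban1983to89.B1Ineq234Concrete (tdist_self)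
open Literature.MathematicalPhysics.QuantumFieldTheory.Balaban1983to89.B1Props21to23RegularTorus (ineq234_236_regular_torus_std)
open Literature.MathematicalPhysics.QuantumFieldTheory.King1986.ContinuumLimit (Thm33Printed IsRegular35)

variable {N : ℕ}

/-! ## §1 The family: index, geometry, backgrounds, kernel -/

/-- THE FAMILY INDEX: a cubic torus of the (Higgs)₂,₃ carrier in r14's sub-family (`Shape`), with `P.d = d`, `P.L = L`, cube size `K₀` («M», `K₀ ∣ M`,
`3K₀ ≤ 2M`), a level `1 ≤ k < K_P` with `L^kε ≤ 1`, and a set `Λ ⊂ T₁^{(k)}`. [cite: Balaban1985BackgroundPropagators, Thm 3.15 p.432 «Λ ⊂ T₁^{(k)}»]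
[cite: Balaban1982Higgs1, Prop. 2.3 (2.32) p.611] -/
structure HiggsCovIdx (d L K₀ : ℕ) where
  /-- the torus -/
  P : HiggsLattice.Params
  S : Shape P
  hPd : P.d = d
  hPL : P.L = L
  hK₀M : K₀ ∣ P.M
  h3M : 3 * K₀ ≤ 2 * P.M
  /-- the level -/
  k : ℕ
  hk1 : 1 ≤ k
  hkK : k < P.K
  hmesh : P.mesh k ≤ 1
  /-- the conditioning set `Λ ⊂ T₁^{(k)}` -/
  Λ : Finset (HiggsLattice.Site P k)

/-- The family at a cube size `K₀ = L^r` is INHABITED (odd `L > 1`, `d ≥ 1`): the cubic torus with `M = L^{r+1}`, `L′_μ = 1`, `K = 2`, `ε = L^{−2}`,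
level `k = 1`, `Λ = ∅` (so the by-name statement below, whose cube size is a power of `L`, is not vacuous). [folklore] -/
theorem higgsCovIdx_nonempty (d L r : ℕ) (hd : 1 ≤ d) (hL : Odd L ∧ 1 < L) : Nonempty (HiggsCovIdx d L (L ^ r)) := by
  have hL0 : 0 < L := by omega
  have hLr : (0 : ℝ) < L := by exact_mod_cast hL0
  have hM0 : 0 < L ^ (r + 1) := pow_pos hL0 _
  have hPε : (0 : ℝ) < ((L : ℝ) ^ 2)⁻¹ := by positivity
  let P : HiggsLattice.Params := ⟨d, ((L : ℝ) ^ 2)⁻¹, 2, L, L ^ (r + 1), fun _ => 1, hd, hPε, hL0, hM0, fun _ => one_pos⟩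
  have h3 : 3 * L ^ r ≤ 2 * P.M := by
    show 3 * L ^ r ≤ 2 * L ^ (r + 1)
    rw [pow_succ]
    have : 3 ≤ 2 * L := by omega
    nlinarith [pow_pos hL0 r]
  have hmesh : P.mesh 1 ≤ 1 := by
    show (L : ℝ) ^ 1 * ((L : ℝ) ^ 2)⁻¹ ≤ 1
    rw [pow_one, ← div_eq_mul_inv, div_le_one (by positivity)]
    have h1 : (1 : ℝ) ≤ L := by exact_mod_cast hL0
    nlinarith
  exact ⟨{ P := P, S := ⟨r + 1, hL, fun _ => by show L ^ (r + 1) * 1 = L ^ (r + 1); rw [mul_one]⟩, hPd := rfl, hPL := rfl,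
           hK₀M := ⟨L, by show L ^ (r + 1) = L ^ r * L; rw [pow_succ]⟩, h3M := h3, k := 1, hk1 := le_rfl,
           hkK := by show 1 < 2; omega, hmesh := hmesh, Λ := ∅ }⟩

variable (C : ChargeData N) {d L K₀ : ℕ}

/-- ★ **THE [B9] GEOMETRY OF THE (Higgs)₂,₃ UNIT LATTICE AT LEVEL `k`**: sites = `T^{(k)}` (`HiggsLattice.Site P k`) with the (1.3) distance in
unit-lattice units, every site of scale `k`, `η = L^{−k}`, `L`, the big-cube size `M := K₀`; `Loc` = η-lattice fields `T_ε → ℝ^N`, `suppIn λ y` = `λ`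
vanishes off the block `B^k(y)`, `suppInT λ y` = off the blocks within distance `1` of `y`, `supNorm = ‖·‖`; the `L²` ∕ weighted ∕ Hölder norms and
the cut-offs are INERT (`0`, `Unit`) — Theorem 3.15 reads none of them. [cite: Balaban1985BackgroundPropagators, Sect. A (3.39)–(3.41) pp.396–397, Thm 3.15 p.432] -/
@[reducible] def higgsGeo (i : HiggsCovIdx d L K₀) : B9.Geometry where
  Site := HiggsLattice.Site i.P i.k
  scale := fun _ => i.k
  dist := fun y y' => (HiggsLattice.Site.tdist y y' : ℝ)
  k := i.k
  eta := ((L : ℝ) ^ i.k)⁻¹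
  L := L
  M := K₀
  Loc := HiggsLattice.ScalarField i.P 0 N
  suppIn := fun lam y => ∀ z, lam z ≠ 0 → blockIter i.k z = y
  suppInT := fun lam y => ∀ z, lam z ≠ 0 → HiggsLattice.Site.tdist (blockIter i.k z) y ≤ 1
  supNorm := fun lam => ‖lam‖
  l2Norm := fun _ => 0
  wNorm := fun _ _ => 0
  holder := fun _ _ => 0
  Cut := Unit
  cutIn := fun _ _ => True
  cutInT := fun _ _ => True
  cutH := fun _ _ => 0
  cutSup := fun _ => 0
  suppInT_of_suppIn := fun lam y h z hz => by rw [h z hz, tdist_self]; exact zero_le_one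
  cutInT_of_cutIn := fun _ _ h => h

/-- ★ **THE [B9] BACKGROUNDS OF THE ABELIAN MODEL**: configurations = real vector fields on the bonds of `T_ε`, `1 = 0`, `U′U = A′ + A`; **(3.35)** read as
its GRADIENT clause in the model's one-parameter currency, `Reg335 c α₀ A := ∀ z μ ν, L^k·|e|·|A_μ(z + εe_ν) − A_μ(z)| ≤ c·α₀` («charge × unit-lattice
gradient small»; the sup clause is gauge bookkeeping on each cube, not modelled); (3.36) = the same for second differences (typed, unused here);
(3.37)–(3.38) := `False` (no complexified fields on this real carrier: any schema READING them is vacuous on this family).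
[cite: Balaban1985BackgroundPropagators, (3.35)–(3.38) p.396] [cite: Balaban1982Higgs1, Prop. 2.1 (2.23) p.610] -/
@[reducible] def higgsBg (i : HiggsCovIdx d L K₀) : B9.Backgrounds where
  Cfg := HiggsLattice.VecField i.P 0
  one := 0
  mul := fun A' A => A' + A
  Reg335 := fun c α₀ A => ∀ (z : HiggsLattice.Site i.P 0) (μ ν : Fin i.P.d),
    (i.P.L : ℝ) ^ i.k * |C.e| * |A ⟨z.shift ν, μ⟩ - A ⟨z, μ⟩| ≤ c * α₀
  Reg336 := fun c α₀ A => ∀ (z : HiggsLattice.Site i.P 0) (μ ν ν' : Fin i.P.d),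
    (i.P.L : ℝ) ^ i.k * |C.e| * |A ⟨(z.shift ν).shift ν', μ⟩ - A ⟨z.shift ν, μ⟩ - A ⟨z.shift ν', μ⟩ + A ⟨z, μ⟩| ≤ c * α₀
  Cplx337 := fun _ _ _ => False
  Cplx338 := fun _ _ _ => False

/-- ★ **THE KERNEL `C^{(k)}(Λ; y, y′)` OF THE MODEL**: the `ℓ¹` block norm of the `N×N` block `(y, y′)` of the conditional fluctuation covariance
`C^{(k),L^kε}_Λ(T_ε, A)` ([Ba1] (2.32), r14's `condCov232 … Λ`) rescaled to the unit lattice by `(L^kε)^{−2}` ((2.30)∕(2.31)).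
[cite: Balaban1985BackgroundPropagators, Thm 3.15 (3.187) p.432] [cite: Balaban1982Higgs1, (2.30)–(2.32) p.611] -/
@[reducible] def higgsCk (a msq : ℝ) (i : HiggsCovIdx d L K₀) : B9.SiteKernel (higgsGeo (N := N) i) (higgsBg C i) where
  ker := fun A y y' => (i.P.mesh i.k ^ 2)⁻¹ * blockNormK (condCov232 C Finset.univ A msq a i.k i.Λ) y y'

/-- `A = 0` lies in every (3.35)-window of the model (`α₀ ≥ 0`, `c ≥ 0`): the by-name statement below is not void. [cite: Balaban1985BackgroundPropagators, (3.35) p.396] -/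
theorem reg335_higgsBg_zero (i : HiggsCovIdx d L K₀) {c α₀ : ℝ} (hc : 0 ≤ c) (hα : 0 ≤ α₀) :
    (higgsBg C i).Reg335 c α₀ (0 : HiggsLattice.VecField i.P 0) := by
  intro z μ ν
  simp only [Pi.zero_apply, sub_self, abs_zero, mul_zero]
  positivity

/-- THE WINDOW IS LIVE: every field whose one-step differences are `≤ δ` with `L^k·|e|·δ ≤ c·α₀` satisfies `Reg335 c α₀`. [cite: Balaban1985BackgroundPropagators, (3.35) p.396] -/
theorem reg335_higgsBg_of_oneStep (i : HiggsCovIdx d L K₀) {c α₀ δ : ℝ} (A : HiggsLattice.VecField i.P 0)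
    (hA : ∀ (z : HiggsLattice.Site i.P 0) (μ ν : Fin i.P.d), |A ⟨z.shift ν, μ⟩ - A ⟨z, μ⟩| ≤ δ)
    (hδ : (i.P.L : ℝ) ^ i.k * |C.e| * δ ≤ c * α₀) : (higgsBg C i).Reg335 c α₀ A := by
  intro z μ ν
  exact (mul_le_mul_of_nonneg_left (hA z μ ν) (by positivity)).trans hδ

/-! ## §2 Theorem 3.15 BY NAME at live regular backgrounds -/

/-- ★★★ **[B9] THEOREM 3.15 (3.187) BY NAME AT LIVE REGULAR BACKGROUNDS IN THE ABELIAN (Higgs)₂,₃ MODEL**: for `L` odd `> 1`, `a, m² > 0`, `N`,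
`(e, q)` there is a cube size `K₀ = L^r` (a power of `L`, so that the family is inhabited) such that for every `c₃₅ > 0`, `B9.Thm315Printed c₃₅ higgsGeo higgsBg higgsCk (· ∈ Λ) |·−·|` holds on the
family `HiggsCovIdx d L K₀`: `∃ δ₀ a₀ B₀ > 0 ∀ i ∀ α₀ > 0, K₀α₀ ≤ a₀ → ∀ A, Reg335 c₃₅ α₀ A → Reg336 c₃₅ α₀ A → ∀ y y′ ∈ Λ, |C^{(k)}_Λ(T, A)(y, y′)|
≤ B₀e^{−δ₀|y−y′|}` — r14 g13's `ineq234_236_regular_torus_std` ([Ba1] (2.34) at a regular torus field, every `Λ`) BY NAME, with the regularity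
parameter `δ` := the maximum one-step difference of `A`. [cite: Balaban1985BackgroundPropagators, Thm 3.15 (3.187) p.432, (3.35)–(3.36) p.396]
[cite: Balaban1982Higgs1, Prop. 2.3 (2.34) p.611, Prop. 2.1 (2.23) p.610] -/
theorem thm315Printed_higgs_regularField (d L : ℕ) (hL : Odd L ∧ 1 < L) {a msq : ℝ} (ha : 0 < a) (hmsq : 0 < msq) (N : ℕ)
    (C : ChargeData N) :
    ∃ K₀ : ℕ, (∃ r : ℕ, K₀ = L ^ r) ∧ ∀ c35 : ℝ, 0 < c35 →
      B9.Thm315Printed c35 (fun i : HiggsCovIdx d L K₀ => higgsGeo (N := N) i) (fun i => higgsBg C i)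
        (fun i => higgsCk C a msq i) (fun i y => y ∈ i.Λ) (fun _ y y' => (HiggsLattice.Site.tdist y y' : ℝ)) := by
  obtain ⟨K₅, tC, cC, δC, hCpos, hCov⟩ := ineq234_236_regular_torus_std d L hL ha hmsq N C
  -- the family's cube size: a power of `L` above r14's threshold (so that the family is inhabited, `higgsCovIdx_nonempty`)
  refine ⟨L ^ K₅, ⟨K₅, rfl⟩, fun c35 hc35 => ?_⟩
  set K₀ := L ^ K₅ with hK₀def
  have hK₀5 : K₅ ≤ K₀ := (Nat.lt_pow_self hL.2).le
  have hK₀pos : 0 < K₀ := pow_pos (by omega) _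
  have hK₀1 : (0 : ℝ) < K₀ := by exact_mod_cast hK₀pos
  set n2 : ℝ := (Fintype.card (Ix N) : ℝ) ^ 2 with hn2
  refine ⟨δC K₀, tC K₀ * K₀ / c35, n2 * cC K₀ + 1, (hCpos K₀).2.2, by have := (hCpos K₀).1; positivity,
    by have := (hCpos K₀).2.1; positivity, ?_⟩
  intro i α₀ hα₀ hMα A hreg _h336 y y' hy hy'
  -- the regularity parameter: the maximum one-step difference of `A`
  classical
  obtain ⟨z₀, -⟩ : ∃ z : HiggsLattice.Site i.P 0, True := ⟨default, trivial⟩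
  have hd1 : 1 ≤ i.P.d := i.P.hd
  set T : Finset (HiggsLattice.Site i.P 0 × Fin i.P.d × Fin i.P.d) := Finset.univ with hT
  have hTne : T.Nonempty := ⟨(z₀, ⟨0, hd1⟩, ⟨0, hd1⟩), Finset.mem_univ _⟩
  set δ : ℝ := T.sup' hTne fun p => |A ⟨p.1.shift p.2.2, p.2.1⟩ - A ⟨p.1, p.2.1⟩| with hδdef
  have hAδ : ∀ (z : HiggsLattice.Site i.P 0) (μ ν : Fin i.P.d), |A ⟨z.shift ν, μ⟩ - A ⟨z, μ⟩| ≤ δ := fun z μ ν =>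
    Finset.le_sup' (f := fun p : HiggsLattice.Site i.P 0 × Fin i.P.d × Fin i.P.d => |A ⟨p.1.shift p.2.2, p.2.1⟩ - A ⟨p.1, p.2.1⟩|)
      (Finset.mem_univ (z, μ, ν))
  obtain ⟨p₀, _, hp₀⟩ := Finset.exists_mem_eq_sup' hTne fun p => |A ⟨p.1.shift p.2.2, p.2.1⟩ - A ⟨p.1, p.2.1⟩|
  have hδ0 : 0 ≤ δ := by rw [hδdef, hp₀]; exact abs_nonneg _
  -- the one smallness `L^kδ|e| ≤ t(K₀)` from `Reg335` at the maximiser and `K₀α₀ ≤ t(K₀)K₀/c₃₅`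
  have hLk : (0 : ℝ) < (i.P.L : ℝ) ^ i.k := pow_pos (by exact_mod_cast i.P.hL) _
  have ht : (i.P.L : ℝ) ^ i.k * δ * |C.e| ≤ tC K₀ := by
    have h1 : (i.P.L : ℝ) ^ i.k * |C.e| * δ ≤ c35 * α₀ := by rw [hδdef, hp₀]; exact hreg p₀.1 p₀.2.1 p₀.2.2
    have h2 : c35 * α₀ ≤ tC K₀ := by
      have hM : (K₀ : ℝ) * α₀ ≤ tC K₀ * K₀ / c35 := hMα
      rw [le_div_iff₀ hc35] at hM
      nlinarith [(hCpos K₀).1]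
    calc (i.P.L : ℝ) ^ i.k * δ * |C.e| = (i.P.L : ℝ) ^ i.k * |C.e| * δ := by ring
      _ ≤ tC K₀ := h1.trans h2
  have hC' := hCov K₀ hK₀5 i.P i.S i.hPd i.hPL i.hK₀M i.h3M i.hk1 i.hkK i.hmesh A hδ0 hAδ ht
  -- the block bound
  have hmesh : 0 < i.P.mesh i.k := i.P.mesh_pos _
  have hb := blockNormK_le (condCov232 C Finset.univ A msq a i.k i.Λ) y y'
    (b := i.P.mesh i.k ^ 2 * cC K₀ * Real.exp (-(δC K₀ * (HiggsLattice.Site.tdist y y' : ℝ))))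
    fun j j' => by simpa using (hC' i.Λ (p := (y, j)) (q := (y', j')) hy hy').1
  show |(i.P.mesh i.k ^ 2)⁻¹ * blockNormK (condCov232 C Finset.univ A msq a i.k i.Λ) y y'|
      ≤ (n2 * cC K₀ + 1) * Real.exp (-(δC K₀ * (HiggsLattice.Site.tdist y y' : ℝ)))
  rw [abs_of_nonneg (mul_nonneg (inv_nonneg.2 (sq_nonneg _)) (blockNormK_nonneg _ _ _))]
  have hexp : 0 ≤ Real.exp (-(δC K₀ * (HiggsLattice.Site.tdist y y' : ℝ))) := Real.exp_nonneg _
  calc (i.P.mesh i.k ^ 2)⁻¹ * blockNormK (condCov232 C Finset.univ A msq a i.k i.Λ) y y'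
      ≤ (i.P.mesh i.k ^ 2)⁻¹ * (n2 * (i.P.mesh i.k ^ 2 * cC K₀ * Real.exp (-(δC K₀ * (HiggsLattice.Site.tdist y y' : ℝ))))) :=
        mul_le_mul_of_nonneg_left hb (inv_nonneg.2 (sq_nonneg _))
    _ = n2 * cC K₀ * Real.exp (-(δC K₀ * (HiggsLattice.Site.tdist y y' : ℝ))) := by field_simp
    _ ≤ (n2 * cC K₀ + 1) * Real.exp (-(δC K₀ * (HiggsLattice.Site.tdist y y' : ℝ))) :=
        mul_le_mul_of_nonneg_right (le_add_of_nonneg_right zero_le_one) hexp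


/-! ## §3 King's Definition 3.2 BY NAME as the hypothesis of PART Θ⁺ -/

section Def32

variable {P : HiggsLattice.Params}

/-- King's Definition 3.2 (3.5) BY NAME (`ContinuumLimit.IsRegular35` on the whole torus, spacing `η > 0`) gives the one-step form used by r14∕p35:
`|A_ν(z + εe_μ) − A_ν(z)| ≤ η·C(e s^{2−d∕2})^{β−1}`. [cite: King1986, Def. 3.2 (3.5) p.655] -/
theorem oneStep_of_isRegular35 {A : HiggsLattice.VecField P 0} {η Cc e s β : ℝ} (hη : 0 < η)
    (h : IsRegular35 P 0 Set.univ η Cc e s β A) :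
    ∀ (z : HiggsLattice.Site P 0) (μ ν : Fin P.d),
      |A ⟨z.shift ν, μ⟩ - A ⟨z, μ⟩| ≤ η * (Cc * (e * s ^ (2 - (P.d : ℝ) / 2)) ^ (β - 1)) := by
  intro z μ ν
  have h1 := h z (Set.mem_univ _) ν μ
  rw [abs_mul, abs_inv, abs_of_pos hη, inv_mul_le_iff₀ hη] at h1
  exact h1

/-- The right side of (3.5) is non-negative as soon as the lattice has a site (it dominates an absolute value). [cite: King1986, Def. 3.2 (3.5) p.655] -/
theorem isRegular35_rhs_nonneg {A : HiggsLattice.VecField P 0} {η Cc e s β : ℝ} (h : IsRegular35 P 0 Set.univ η Cc e s β A) :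
    0 ≤ Cc * (e * s ^ (2 - (P.d : ℝ) / 2)) ^ (β - 1) :=
  (abs_nonneg _).trans (h default (Set.mem_univ _) ⟨0, P.hd⟩ ⟨0, P.hd⟩)

/-- ★★ **PART Θ⁺ WITH KING's DEFINITION 3.2 BY NAME AS THE HYPOTHESIS**: for every cube size `K₀ ≥ K₀min`, every cubic torus, every level
`1 ≤ k < K_P` with `L^kε ≤ 1`, every spacing `η > 0` and every field `A` that is regular on `T_η` in the sense of Definition 3.2
(`IsRegular35 P 0 univ η C e s β A`) with the one smallness `L^k·η·C(e s^{2−d∕2})^{β−1}·|e| ≤ t(K₀)` («for e(L^kε) sufficiently small»):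
`Thm33Printed (kingThm33DataReg …)` — both ends of Theorem 3.3 by name. [cite: King1986, Def. 3.2 (3.5) p.655, Thm 3.3 (3.6)–(3.8) pp.655–656] -/
theorem thm33Printed_king_of_isRegular35 (d L : ℕ) (hL : Odd L ∧ 1 < L) {a msq : ℝ} (ha : 0 < a) (hmsq : 0 < msq) (N : ℕ)
    (C : ChargeData N) :
    ∃ K₀min : ℕ, ∃ t : ℕ → ℝ, (∀ K₀, 0 < t K₀) ∧ ∀ K₀ : ℕ, K₀min ≤ K₀ →
      ∀ (P : HiggsLattice.Params) (_S : Shape P), P.d = d → P.L = L → K₀ ∣ P.M → 3 * K₀ ≤ 2 * P.M →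
      ∀ {k : ℕ}, 1 ≤ k → k < P.K → P.mesh k ≤ 1 →
      ∀ (A : HiggsLattice.VecField P 0) {η Cc e s β : ℝ}, 0 < η → IsRegular35 P 0 Set.univ η Cc e s β A →
        (P.L : ℝ) ^ k * (η * (Cc * (e * s ^ (2 - (P.d : ℝ) / 2)) ^ (β - 1))) * |C.e| ≤ t K₀ →
        Thm33Printed (kingThm33DataReg C P k A a msq) := by
  obtain ⟨K₀min, t, ht, h⟩ := thm33Printed_king_regularField d L hL ha hmsq N C
  refine ⟨K₀min, t, ht, fun K₀ hK₀ P S hPd hPL hK₀M h3M k hk1 hkK hs A η Cc e s β hη hreg hsmall => ?_⟩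
  exact h K₀ hK₀ P S hPd hPL hK₀M h3M hk1 hkK hs A (mul_nonneg hη.le (isRegular35_rhs_nonneg hreg))
    (oneStep_of_isRegular35 hη hreg) hsmall

/-- NON-VACUITY OF PART Θ⁺'s FAMILY: above every cube-size threshold there is an admissible cube size (`K₀ = L^r`) with a cubic torus and a level meeting
all the side conditions of `thm33Printed_king_regularField` ∕ `thm33Printed_king_of_isRegular35` (the member of `higgsCovIdx_nonempty`). [folklore] -/
theorem thm33_family_nonempty (d L K₀min : ℕ) (hd : 1 ≤ d) (hL : Odd L ∧ 1 < L) :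
    ∃ K₀ : ℕ, K₀min ≤ K₀ ∧ ∃ (P : HiggsLattice.Params) (_S : Shape P) (k : ℕ),
      P.d = d ∧ P.L = L ∧ K₀ ∣ P.M ∧ 3 * K₀ ≤ 2 * P.M ∧ 1 ≤ k ∧ k < P.K ∧ P.mesh k ≤ 1 := by
  obtain ⟨i⟩ := higgsCovIdx_nonempty d L K₀min hd hL
  exact ⟨L ^ K₀min, (Nat.lt_pow_self hL.2).le, i.P, i.S, i.k, i.hPd, i.hPL, i.hK₀M, i.h3M, i.hk1, i.hkK, i.hmesh⟩

end Def32

end Summit.QuantumFields.YangMills.BalabanUVNodes.N15KingModelRung.Curved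

end
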